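import Literature.Geometry.Manifold.BilinSectionTransport
import Literature.Topology.FourManifolds.SeamBicollar
import Literature.Topology.FourManifolds.ImmersionOrientation
import HarnessLib

/-!
# Differential calculus in a seam chart

Topic `Literature/Topology/FourManifolds` (namespace `Literature.Topology.FourManifolds`). For an
equidimensional `C^∞` embedding `jA : A ↪ X` of a manifold with boundary into a boundaryless
manifold, the seam charts `K : ℝᵏ⁺² ⇀ X` of `SeamBicollar.exists_seamChart` satisfy
`K = jA ∘ kA` on the closed half space (`kA : ℝᵏ⁺²₊ ↪ A` a half-disc chart) and see `jA(A)`
exactly from above. This file records the first-order consequences used by the metric-extension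
and boundary-collar steps of the programme of
`Literature.Geometry.Riemannian.BaerHankePscGluing` (layer L1):

* `mfderiv_seamChart_eq_comp` — **`dK_x = d(jA)_{kA x} ∘ d(kA)_x`** at points `x` of the closed
  half space inside `K.source` (also at points of the boundary hyperplane): the two maps agree on
  the relatively open set `{x | x.val ∈ K.source}` of the half space, whose model map has
  identity differential (`mfderiv_comp_modelWithCorners`);
* `mfderiv_symm_seamChart_apply` — `d(K⁻¹)_{K x} (dK_x u) = u` (Mathlib's `symm_comp_deriv`);
* `surjective_mfderiv_of_isImmersionAt` — the differential of an equidimensional `C^∞`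
  immersion between manifolds with boundary is onto, also at boundary points
  (`injective_mfderiv_of_isImmersionAt'` and a dimension count);
* `mfderiv_symm_seamChart_mfderiv_comp` — consequently `d(K⁻¹) ∘ d(jA) ∘ d(kA) = id` at such `x`.

No definitions, no named facts (D-0026).

## References

* M. W. Hirsch, *Differential Topology* (1976), Ch. 8 §1, proof of Thm. 1.9 (bicollaring the
  seam). [HirschDT1976]
* J. M. Lee, *Introduction to Smooth Manifolds*, 2nd ed. (2013), Prop. 4.1, Thm. 4.14.
  [LeeSmoothManifolds2013]
-/

noncomputable section

open Set Function Filter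
open scoped Manifold ContDiff Topology

namespace Literature.Topology.FourManifolds

open Literature.Geometry.Manifold

/-! ### Equidimensional immersions have surjective differential, also at boundary points -/

section Surjective

variable {E : Type*} [NormedAddCommGroup E] [NormedSpace ℝ E] [FiniteDimensional ℝ E]
  {H : Type*} [TopologicalSpace H] {I : ModelWithCorners ℝ E H}
  {G : Type*} [TopologicalSpace G] {J : ModelWithCorners ℝ E G}
  {M : Type*} [TopologicalSpace M] [ChartedSpace H M]
  {N : Type*} [TopologicalSpace N] [ChartedSpace G N]

/-- **The differential of an equidimensional `C^∞` immersion is onto**, at every point including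
boundary points (it is injective, `injective_mfderiv_of_isImmersionAt'`, between tangent spaces
which are both the model vector space). [cite: LeeSmoothManifolds2013, Prop. 4.1 and Thm. 4.14] -/
theorem surjective_mfderiv_of_isImmersionAt {f : M → N} {x : M}
    (h : Manifold.IsImmersionAt I J ∞ f x) : Surjective (mfderiv I J f x) := by
  haveI : FiniteDimensional ℝ (TangentSpace I x) := inferInstanceAs (FiniteDimensional ℝ E)
  exact LinearMap.surjective_of_injective (f := ((mfderiv I J f x :
    TangentSpace I x →L[ℝ] TangentSpace J (f x)) : TangentSpace I x →ₗ[ℝ] TangentSpace J (f x)))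
    (injective_mfderiv_of_isImmersionAt' h)

end Surjective

/-! ### The differential of a seam chart on the closed half space -/

section SeamChart

variable {k : ℕ} {A : Type*} [TopologicalSpace A] [ChartedSpace (EuclideanHalfSpace (k + 1)) A]
  {X : Type*} [TopologicalSpace X] [ChartedSpace (EuclideanSpace ℝ (Fin (k + 1))) X]
  {jA : A → X} {kA : EuclideanHalfSpace (k + 1) → A}
  {K : OpenPartialHomeomorph (EuclideanSpace ℝ (Fin (k + 1))) X}

/-- **`dK_x = d(jA) ∘ d(kA)_x` on the closed half space.** If `K` agrees with `jA ∘ kA` at the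
points of the half space in `K.source` (`exists_seamChart`), `K` is `C^∞` on its source and
`jA`, `kA` are `C^∞`, then for every `x` of the half space with `x.val ∈ K.source` and every
`u ∈ ℝᵏ⁺¹ = T_x ℝᵏ⁺¹₊`: `dK_{x}(u) = d(jA)_{kA x}(d(kA)_x u)` (the composites `jA ∘ kA` and
`K ∘ ι`, `ι` the model map of the half space, agree near `x`, and `dι = id`).
[cite: HirschDT1976, Ch. 8 §1, proof of Thm. 1.9] -/
theorem mfderiv_seamChart_eq_comp
    (hKs : ContMDiffOn 𝓘(ℝ, EuclideanSpace ℝ (Fin (k + 1))) (𝓡 (k + 1)) ∞ K K.source)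
    (hKG : ∀ x : EuclideanHalfSpace (k + 1), x.val ∈ K.source → K x.val = jA (kA x))
    (hjA : ContMDiff (𝓡∂ (k + 1)) (𝓡 (k + 1)) ∞ jA)
    (hkA : ContMDiff (𝓡∂ (k + 1)) (𝓡∂ (k + 1)) ∞ kA)
    {x : EuclideanHalfSpace (k + 1)} (hxK : x.val ∈ K.source)
    (u : EuclideanSpace ℝ (Fin (k + 1))) :
    mfderiv 𝓘(ℝ, EuclideanSpace ℝ (Fin (k + 1))) (𝓡 (k + 1)) K x.val u =
      mfderiv (𝓡∂ (k + 1)) (𝓡 (k + 1)) jA (kA x)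
        (mfderiv (𝓡∂ (k + 1)) (𝓡∂ (k + 1)) kA x u) := by
  have hjd : MDifferentiableAt (𝓡∂ (k + 1)) (𝓡 (k + 1)) jA (kA x) :=
    (hjA (kA x)).mdifferentiableAt (by simp)
  have hkd : MDifferentiableAt (𝓡∂ (k + 1)) (𝓡∂ (k + 1)) kA x :=
    (hkA x).mdifferentiableAt (by simp)
  have hKd : MDifferentiableAt 𝓘(ℝ, EuclideanSpace ℝ (Fin (k + 1))) (𝓡 (k + 1)) K
      ((𝓡∂ (k + 1)) x) :=
    ((hKs _ hxK).contMDiffAt (K.open_source.mem_nhds hxK)).mdifferentiableAt (by simp)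
  have hev : (jA ∘ kA) =ᶠ[𝓝 x] (K ∘ (𝓡∂ (k + 1))) := by
    have ho : IsOpen {x' : EuclideanHalfSpace (k + 1) | x'.val ∈ K.source} :=
      K.open_source.preimage continuous_subtype_val
    filter_upwards [ho.mem_nhds hxK] with x' hx'
    exact (hKG x' hx').symm
  have hdjk : mfderiv (𝓡∂ (k + 1)) (𝓡 (k + 1)) (jA ∘ kA) x =
      (mfderiv (𝓡∂ (k + 1)) (𝓡 (k + 1)) jA (kA x)).comp
        (mfderiv (𝓡∂ (k + 1)) (𝓡∂ (k + 1)) kA x) := mfderiv_comp x hjd hkd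
  have hdKI : mfderiv (𝓡∂ (k + 1)) (𝓡 (k + 1)) (K ∘ (𝓡∂ (k + 1))) x =
      mfderiv 𝓘(ℝ, EuclideanSpace ℝ (Fin (k + 1))) (𝓡 (k + 1)) K ((𝓡∂ (k + 1)) x) :=
    mfderiv_comp_modelWithCorners hKd
  have h := DFunLike.congr_fun (hdjk.symm.trans (hev.mfderiv_eq.trans hdKI)) u
  exact h.symm

/-- **`d(K⁻¹)_{K x}(dK_x u) = u`** for a chart `K` which is `C^∞` on its source with `C^∞`
inverse on its target (Mathlib's `OpenPartialHomeomorph.MDifferentiable.symm_comp_deriv`).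
[folklore] -/
theorem mfderiv_symm_seamChart_apply
    (hKs : ContMDiffOn 𝓘(ℝ, EuclideanSpace ℝ (Fin (k + 1))) (𝓡 (k + 1)) ∞ K K.source)
    (hKs' : ContMDiffOn (𝓡 (k + 1)) 𝓘(ℝ, EuclideanSpace ℝ (Fin (k + 1))) ∞ K.symm K.target)
    {y : EuclideanSpace ℝ (Fin (k + 1))} (hy : y ∈ K.source) (u : EuclideanSpace ℝ (Fin (k + 1))) :
    mfderiv (𝓡 (k + 1)) 𝓘(ℝ, EuclideanSpace ℝ (Fin (k + 1))) K.symm (K y)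
        (mfderiv 𝓘(ℝ, EuclideanSpace ℝ (Fin (k + 1))) (𝓡 (k + 1)) K y u) = u := by
  have hKmd : K.MDifferentiable 𝓘(ℝ, EuclideanSpace ℝ (Fin (k + 1))) (𝓡 (k + 1)) :=
    ⟨hKs.mdifferentiableOn (by simp), hKs'.mdifferentiableOn (by simp)⟩
  exact DFunLike.congr_fun (hKmd.symm_comp_deriv hy) u

/-- **`d(K⁻¹) ∘ d(jA) ∘ d(kA) = id` at points of the closed half space**: combination of
`mfderiv_seamChart_eq_comp` and `mfderiv_symm_seamChart_apply`.
[cite: HirschDT1976, Ch. 8 §1, proof of Thm. 1.9] -/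
theorem mfderiv_symm_seamChart_mfderiv_comp
    (hKs : ContMDiffOn 𝓘(ℝ, EuclideanSpace ℝ (Fin (k + 1))) (𝓡 (k + 1)) ∞ K K.source)
    (hKs' : ContMDiffOn (𝓡 (k + 1)) 𝓘(ℝ, EuclideanSpace ℝ (Fin (k + 1))) ∞ K.symm K.target)
    (hKG : ∀ x : EuclideanHalfSpace (k + 1), x.val ∈ K.source → K x.val = jA (kA x))
    (hjA : ContMDiff (𝓡∂ (k + 1)) (𝓡 (k + 1)) ∞ jA)
    (hkA : ContMDiff (𝓡∂ (k + 1)) (𝓡∂ (k + 1)) ∞ kA)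
    {x : EuclideanHalfSpace (k + 1)} (hxK : x.val ∈ K.source)
    (u : EuclideanSpace ℝ (Fin (k + 1))) :
    mfderiv (𝓡 (k + 1)) 𝓘(ℝ, EuclideanSpace ℝ (Fin (k + 1))) K.symm (K x.val)
        (mfderiv (𝓡∂ (k + 1)) (𝓡 (k + 1)) jA (kA x)
          (mfderiv (𝓡∂ (k + 1)) (𝓡∂ (k + 1)) kA x u)) = u := by
  rw [← mfderiv_seamChart_eq_comp hKs hKG hjA hkA hxK u]
  exact mfderiv_symm_seamChart_apply hKs hKs' hxK u

end SeamChart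

end Literature.Topology.FourManifolds
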